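import Literature.Analysis.Approximation.TuranNazarovProofs
import Mathlib.Analysis.Complex.Harmonic.Poisson
import Mathlib.Analysis.InnerProductSpace.Harmonic.Constructions
import Mathlib.Analysis.Complex.BorelCaratheodory
import Mathlib.Analysis.Complex.HasPrimitives
import Mathlib.Analysis.Complex.Liouville
import Mathlib.Analysis.Complex.AbsMax
import Mathlib.Analysis.Meromorphic.FactorizedRational
import Mathlib.Analysis.Complex.JensenFormula
import HarnessLib

/-!
# Turán–Nazarov inequality, proofs — Part 3: zero-free quotients, extraction of zeros, and the effective zero product

Third file of the formalization of O. Friedland, *A disk-growth Remez principle and a modular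
proof of the measurable Turán–Nazarov inequality*, arXiv:2606.24823 (2026)
[Friedland2026DiskGrowthRemez], towards discharging
`Literature.Analysis.Approximation.TuranNazarov.lemma` (road map in
`Literature/Analysis/Approximation/TuranNazarovProofs.lean`).  Theorems only.

## Contents

* `harnack` — Harnack's inequality on a disc (from Mathlib's Poisson integral formula
  `HarmonicOnNhd.circleAverage_poissonKernel_smul` and the kernel bounds
  `le_re_herglotzRieszKernel` / `re_herglotzRieszKernel_le`).
* `zero_free_lower` — **Lemma A.3, first half**: `h` analytic and zero-free on `D̄(c,2)`,
  `|h| ≤ M` there ⟹ `log M - log|h(w)| ≤ 21 (log M - log|h(w₀)|)` for `|w-c| ≤ 3/2`,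
  `|w₀-c| ≤ 1` (Harnack chain through the centre; constants `7 · 3`).
* `log_deriv_bound` — **Lemma A.3, second half**: `h` analytic zero-free on `D(c,2)`,
  `|log|h| - log|h(c)|| ≤ K` on `D̄(c,3/2)` ⟹ `|h'/h| ≤ 8K + 8` on `D̄(c,1/2)` (primitive of `h'/h`
  via Mathlib's `DifferentiableOn.isExactOn_ball`, the identity `h = h(c) e^F`,
  `Complex.borelCaratheodory_zero` on `D(c,3/2)`, Cauchy's estimate
  `Complex.norm_deriv_le_of_forall_mem_sphere_norm_le` on circles of radius `1/2`).
* `extract_zeros` — an entire `f ≠ 0` factors on `D(c,R₀)` as `∏_{u ∈ Z} (z-u)^{n_u} · h` with `Z`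
  the zeros in `D̄(c,ρ)`, `n_u = ord_u f ≥ 1` (`= divisor f univ u`), `h` analytic on `D(c,R₀)` and
  zero-free on `D̄(c,ρ)` (Mathlib's `MeromorphicOn.extract_zeros_poles`; the codiscrete equality is
  upgraded to a pointwise one by continuity).  `zeros_enum` lists the zeros with multiplicity as
  `w : Fin N → ℂ`; `count_le_jensen` bounds `∑ n_u` by Mathlib's Jensen inequality
  `AnalyticOnNhd.sum_divisor_le`; `exists_nearest` selects `k` nearest indices.
* `effective_zero_product` — **Prop 2.1** in the form needed later, for an entire `f ≠ 0` with
  ALL-SCALES disk growth `sup_{D̄(z₀,R)}|f| ≤ e^{aR+b}(R/r)^d sup_{D̄(z₀,r)}|f|` (which is what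
  Lemma 3.2 provides for exponential polynomials) and `|f(x₀)| ≥ 1` somewhere on
  `I₀ = [-1/2,1/2]`: the zeros `w_1,…,w_N` in `D̄(0,2)` satisfy `N ≤ 35(a+b+d)`, and for every
  `x ∈ I₀` at most `d` of them, `T`, give `|f(x)| ≥ e^{-2000(a+b+d)} ∏_{i∈T} min(1,|x - Re w_i|)`.
  DEVIATION from the printed proof: Blaschke products are replaced by plain division by the
  polynomial of the zeros in `D̄(0,2)` (the zero-free factor is bounded on `D̄(0,4)` by the maximum
  principle because that polynomial is `≥ 1` on `|z| = 4`), and the local tail estimate (A.2) is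
  run with the GLOBAL factorization and disk growth from `D̄(x,ρ)` to `D̄(x,9/2)`; when the
  `(d+1)`-st nearest zero sits at `x` the asserted inequality is trivial, so no order argument is
  needed.  Constants are explicit but not optimized.
-/

noncomputable section

open Complex Metric Set Real Filter Topology InnerProductSpace

namespace Literature.Analysis.Approximation

namespace TuranNazarov

/-! ### Harnack and the zero-free quotient (Friedland 2026, Lemma A.3) -/

/-- **Harnack's inequality** for a harmonic function `u` on a closed disc which is nonnegative on
the boundary circle: `(R-d)/(R+d) · u(c) ≤ u(w) ≤ (R+d)/(R-d) · u(c)`, `d = ‖w - c‖ < R`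
(Poisson representation with Mathlib's kernel bounds). [folklore] -/
theorem harnack {u : ℂ → ℝ} {c w : ℂ} {R : ℝ} (hu : HarmonicOnNhd u (closedBall c R))
    (hpos : ∀ z ∈ sphere c R, 0 ≤ u z) (hw : w ∈ ball c R) :
    (R - ‖w - c‖) / (R + ‖w - c‖) * u c ≤ u w ∧ u w ≤ (R + ‖w - c‖) / (R - ‖w - c‖) * u c := by
  have hR : 0 < R := lt_of_le_of_lt dist_nonneg (mem_ball.1 hw)
  have habs : |R| = R := abs_of_pos hR
  have hd : ‖w - c‖ < R := by rwa [mem_ball_iff_norm] at hw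
  -- continuity and circle integrability
  have hu_cont : ContinuousOn u (sphere c |R|) := fun z hz =>
    (hu z (by rw [habs] at hz; exact sphere_subset_closedBall hz)).1.continuousAt.continuousWithinAt
  have hP_cont : ContinuousOn (poissonKernel c w) (sphere c |R|) := by
    rw [poissonKernel_eq_re_herglotzRieszKernel]
    refine Complex.continuous_re.comp_continuousOn ?_
    intro z hz
    rw [habs] at hz
    have hne : (z - c) - (w - c) ≠ 0 := by
      intro h
      have : z = w := by linear_combination h
      rw [this, mem_sphere_iff_norm] at hz
      linarith
    unfold herglotzRieszKernel
    exact ContinuousAt.continuousWithinAt (by fun_prop (disch := exact hne))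
  have hi_u : CircleIntegrable u c R := hu_cont.circleIntegrable'
  have hi_Pu : CircleIntegrable (poissonKernel c w • u) c R :=
    (hP_cont.mul hu_cont).circleIntegrable'
  have hmv : circleAverage u c R = u c := HarmonicOnNhd.circleAverage_eq (by rwa [habs])
  have hPo : circleAverage (poissonKernel c w • u) c R = u w :=
    hu.circleAverage_poissonKernel_smul hw
  -- kernel bounds on the sphere
  have hker : ∀ z ∈ sphere c |R|, (R - ‖w - c‖) / (R + ‖w - c‖) ≤ poissonKernel c w z ∧
      poissonKernel c w z ≤ (R + ‖w - c‖) / (R - ‖w - c‖) := by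
    intro z hz
    rw [habs] at hz
    rw [poissonKernel_eq_re_herglotzRieszKernel]
    exact ⟨le_re_herglotzRieszKernel hz hw, re_herglotzRieszKernel_le hz hw⟩
  constructor
  · rw [← hPo, ← hmv, ← smul_eq_mul, ← circleAverage_smul]
    apply circleAverage_mono (hi_u.const_smul) hi_Pu
    intro z hz
    simp only [Pi.smul_apply, smul_eq_mul]
    exact mul_le_mul_of_nonneg_right (hker z hz).1 (hpos z (by rwa [habs] at hz))
  · rw [← hPo, ← hmv, ← smul_eq_mul, ← circleAverage_smul]
    apply circleAverage_mono hi_Pu (hi_u.const_smul)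
    intro z hz
    simp only [Pi.smul_apply, smul_eq_mul]
    exact mul_le_mul_of_nonneg_right (hker z hz).2 (hpos z (by rwa [habs] at hz))

/-- **Zero-free quotient, lower bound** (Friedland 2026, Lemma A.3, first half; Harnack chain
through the centre): if `h` is analytic and zero-free on the closed disc `D̄(c,2)` with `|h| ≤ M`
there, then for `|w - c| ≤ 3/2` and `|w₀ - c| ≤ 1`,
`log M - log|h(w)| ≤ 21 (log M - log|h(w₀)|)`. [cite: Friedland2026DiskGrowthRemez, Lemma A.3] -/
theorem zero_free_lower {h : ℂ → ℂ} {c w₀ w : ℂ} {M : ℝ} (hh : AnalyticOnNhd ℂ h (closedBall c 2))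
    (hne : ∀ z ∈ closedBall c 2, h z ≠ 0) (hM : ∀ z ∈ closedBall c 2, ‖h z‖ ≤ M)
    (hw₀ : w₀ ∈ closedBall c 1) (hw : w ∈ closedBall c (3 / 2)) :
    Real.log M - Real.log ‖h w‖ ≤ 21 * (Real.log M - Real.log ‖h w₀‖) := by
  set u : ℂ → ℝ := fun z => Real.log M - Real.log ‖h z‖ with hu_def
  have hu : HarmonicOnNhd u (closedBall c 2) := by
    intro z hz
    have h1 : HarmonicAt (fun z => Real.log ‖h z‖) z := (hh z hz).harmonicAt_log_norm (hne z hz)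
    have h2 : HarmonicAt (fun _ : ℂ => Real.log M) z := harmonicAt_const (Real.log M)
    exact h2.sub h1
  have hupos : ∀ z ∈ closedBall c 2, 0 ≤ u z := by
    intro z hz
    simp only [hu_def, sub_nonneg]
    exact Real.log_le_log (norm_pos_iff.2 (hne z hz)) (hM z hz)
  have hsph : ∀ z ∈ sphere c 2, 0 ≤ u z := fun z hz => hupos z (sphere_subset_closedBall hz)
  -- Harnack from the centre to `w`, and from `w₀` back to the centre
  have hwb : w ∈ ball c 2 := by
    rw [mem_ball]; rw [mem_closedBall] at hw; linarith
  have hw₀b : w₀ ∈ ball c 2 := by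
    rw [mem_ball]; rw [mem_closedBall] at hw₀; linarith
  have h1 := (harnack hu hsph hwb).2
  have h2 := (harnack hu hsph hw₀b).1
  have hdw : ‖w - c‖ ≤ 3 / 2 := by rwa [mem_closedBall_iff_norm] at hw
  have hdw₀ : ‖w₀ - c‖ ≤ 1 := by rwa [mem_closedBall_iff_norm] at hw₀
  have huc : 0 ≤ u c := hupos c (mem_closedBall_self (by norm_num))
  have huw₀ : 0 ≤ u w₀ := hupos w₀ (closedBall_subset_closedBall (by norm_num) hw₀)
  have hf1 : (2 + ‖w - c‖) / (2 - ‖w - c‖) ≤ 7 := by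
    rw [div_le_iff₀ (by linarith)]; linarith
  have hf2 : 1 / 3 ≤ (2 - ‖w₀ - c‖) / (2 + ‖w₀ - c‖) := by
    rw [div_le_div_iff₀ (by norm_num) (by linarith [norm_nonneg (w₀ - c)])]; linarith
  have h3 : u w ≤ 7 * u c := h1.trans (mul_le_mul_of_nonneg_right hf1 huc)
  have h4 : 1 / 3 * u c ≤ u w₀ := (mul_le_mul_of_nonneg_right hf2 huc).trans h2
  show u w ≤ 21 * u w₀
  linarith

/-- **Zero-free quotient, logarithmic derivative** (Friedland 2026, Lemma A.3, second half): if
`h` is analytic and zero-free on the open disc `D(c,2)` and `|log|h z| - log|h c|| ≤ K` for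
`|z - c| ≤ 3/2`, then `|h'(x)/h(x)| ≤ 8K + 8` for `|x - c| ≤ 1/2` (primitive of `h'/h`,
Borel–Carathéodory on `D(c,3/2)`, Cauchy's estimate on circles of radius `1/2`).
[cite: Friedland2026DiskGrowthRemez, Lemma A.3] -/
theorem log_deriv_bound {h : ℂ → ℂ} {c : ℂ} {K : ℝ} (hh : DifferentiableOn ℂ h (ball c 2))
    (hne : ∀ z ∈ ball c 2, h z ≠ 0)
    (hK : ∀ z ∈ closedBall c (3 / 2), |Real.log ‖h z‖ - Real.log ‖h c‖| ≤ K)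
    {x : ℂ} (hx : x ∈ closedBall c (1 / 2)) :
    ‖deriv h x / h x‖ ≤ 8 * K + 8 := by
  -- a primitive `F` of `h'/h` on the ball with `F c = 0`
  have hld : DifferentiableOn ℂ (fun z => deriv h z / h z) (ball c 2) :=
    (hh.deriv isOpen_ball).div hh hne
  obtain ⟨F, hFc, hF⟩ := (hld.isExactOn_ball).with_val_at c 0
  have hFd : DifferentiableOn ℂ F (ball c 2) := fun z hz => (hF z hz).differentiableAt.differentiableWithinAt
  -- `h = h c · exp F` on the ball
  have hexp : ∀ z ∈ ball c 2, h z = h c * Complex.exp (F z) := by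
    have hG : ∀ z ∈ ball c 2, HasDerivAt (fun z => h z * Complex.exp (-F z)) 0 z := by
      intro z hz
      have h1 : HasDerivAt h (deriv h z) z :=
        (hh.differentiableAt (isOpen_ball.mem_nhds hz)).hasDerivAt
      have h2 : HasDerivAt (fun z => Complex.exp (-F z)) (Complex.exp (-F z) * -(deriv h z / h z)) z :=
        (hF z hz).neg.cexp
      have h3 := h1.mul h2
      have hz0 := hne z hz
      have h4 : deriv h z * Complex.exp (-F z) + h z * (Complex.exp (-F z) * -(deriv h z / h z)) = 0 := by
        field_simp
        ring
      exact h3.congr_deriv h4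
    have hconst : ∀ z ∈ ball c 2, h z * Complex.exp (-F z) = h c * Complex.exp (-F c) := by
      intro z hz
      apply isOpen_ball.is_const_of_deriv_eq_zero (convex_ball c 2).isPreconnected
        (fun z hz => (hG z hz).differentiableAt.differentiableWithinAt)
        (fun z hz => (hG z hz).deriv) hz (mem_ball_self (by norm_num))
    intro z hz
    have := hconst z hz
    rw [hFc, neg_zero, Complex.exp_zero, mul_one] at this
    calc h z = h z * Complex.exp (-F z) * Complex.exp (F z) := by
          rw [mul_assoc, ← Complex.exp_add, neg_add_cancel, Complex.exp_zero, mul_one]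
      _ = h c * Complex.exp (F z) := by rw [this]
  have hre : ∀ z ∈ ball c 2, (F z).re = Real.log ‖h z‖ - Real.log ‖h c‖ := by
    intro z hz
    have hc0 : h c ≠ 0 := hne c (mem_ball_self (by norm_num))
    rw [hexp z hz, norm_mul, Real.log_mul (norm_ne_zero_iff.2 hc0) (by simp [Complex.exp_ne_zero]),
      Complex.norm_exp, Real.log_exp]
    ring
  -- Borel–Carathéodory on `D(c, 3/2)` for `z ↦ F (c + z)`
  have hK0 : 0 ≤ K := le_trans (abs_nonneg _) (hK c (mem_closedBall_self (by norm_num)))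
  have hBC : ∀ z ∈ closedBall c 1, ‖F z‖ ≤ 4 * K + 4 := by
    intro z hz
    set f : ℂ → ℂ := fun v => F (c + v) with hf
    have hfd : DifferentiableOn ℂ f (ball 0 (3 / 2)) := by
      intro v hv
      have : c + v ∈ ball c 2 := by
        rw [mem_ball, dist_eq_norm]; rw [mem_ball_zero_iff] at hv; simp; linarith
      exact ((hFd.differentiableAt (isOpen_ball.mem_nhds this)).comp v
        (differentiableAt_id.const_add c)).differentiableWithinAt
    have hmaps : MapsTo f (ball 0 (3 / 2)) {v | v.re ≤ K + 1} := by
      intro v hv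
      have hv' : c + v ∈ closedBall c (3 / 2) := by
        rw [mem_closedBall, dist_eq_norm]; rw [mem_ball_zero_iff] at hv; simp; linarith
      have hv'' : c + v ∈ ball c 2 := by
        rw [mem_ball, dist_eq_norm]; rw [mem_ball_zero_iff] at hv; simp; linarith
      simp only [mem_setOf_eq, hf, hre _ hv'']
      linarith [(abs_le.1 (hK _ hv')).2]
    have hz' : z - c ∈ ball (0 : ℂ) (3 / 2) := by
      rw [mem_ball_zero_iff]; rw [mem_closedBall_iff_norm] at hz; linarith
    have key := Complex.borelCaratheodory_zero (by linarith) hfd hmaps (by norm_num) hz'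
      (by simp [hf, hFc])
    have hzn : ‖z - c‖ ≤ 1 := by rwa [mem_closedBall_iff_norm] at hz
    simp only [hf, add_sub_cancel] at key
    calc ‖F z‖ ≤ 2 * (K + 1) * ‖z - c‖ / (3 / 2 - ‖z - c‖) := key
      _ ≤ 2 * (K + 1) * 1 / (3 / 2 - 1) := by gcongr
      _ = 4 * K + 4 := by ring
  -- Cauchy's estimate on the circle of radius `1/2` about `x`
  have hxc : ‖x - c‖ ≤ 1 / 2 := by rwa [mem_closedBall_iff_norm] at hx
  have hsub : closedBall x (1 / 2) ⊆ ball c 2 := by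
    intro z hz
    rw [mem_closedBall_iff_norm] at hz
    rw [mem_ball_iff_norm]
    calc ‖z - c‖ = ‖(z - x) + (x - c)‖ := by rw [sub_add_sub_cancel]
      _ ≤ ‖z - x‖ + ‖x - c‖ := norm_add_le _ _
      _ < 2 := by linarith
  have hdc : DiffContOnCl ℂ F (ball x (1 / 2)) :=
    (hFd.mono (by rw [closure_ball x (by norm_num)]; exact hsub)).diffContOnCl
  have hsph : ∀ z ∈ sphere x (1 / 2), ‖F z‖ ≤ 4 * K + 4 := by
    intro z hz
    apply hBC
    rw [mem_sphere_iff_norm] at hz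
    rw [mem_closedBall_iff_norm]
    calc ‖z - c‖ = ‖(z - x) + (x - c)‖ := by rw [sub_add_sub_cancel]
      _ ≤ ‖z - x‖ + ‖x - c‖ := norm_add_le _ _
      _ ≤ 1 := by linarith
  have key := Complex.norm_deriv_le_of_forall_mem_sphere_norm_le (by norm_num) hdc hsph
  rw [(hF x (hsub (mem_closedBall_self (by norm_num)))).deriv] at key
  calc ‖deriv h x / h x‖ ≤ (4 * K + 4) / (1 / 2) := key
    _ = 8 * K + 8 := by ring



/-! ### Extracting zeros; the effective zero product (Friedland 2026, Prop 2.1) -/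

/-- **Extraction of zeros.** Let `f` be entire and not the zero function, `c ∈ ℂ`, `0 ≤ ρ < R₀`.
Then `f = P · h` on `D(c, R₀)`, where `P(z) = ∏_{u ∈ Z} (z - u)^{n_u}` runs over the zeros of `f`
in the closed disc `D̄(c, ρ)` with their multiplicities `n_u = ord_u f ≥ 1`, and `h` is analytic on
`D(c, R₀)` and zero-free on `D̄(c, ρ)` (Mathlib's `MeromorphicOn.extract_zeros_poles` on
`D(c, R₀)`, the factors of the zeros outside `D̄(c, ρ)` being absorbed into `h`). [folklore] -/
theorem extract_zeros {f : ℂ → ℂ} (hf : ∀ z, AnalyticAt ℂ f z) (hf0 : f ≠ 0)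
    (c : ℂ) {ρ R₀ : ℝ} (hρR : ρ < R₀) :
    ∃ (Z : Finset ℂ) (n : ℂ → ℕ) (h : ℂ → ℂ),
      (∀ u, u ∈ Z ↔ f u = 0 ∧ u ∈ closedBall c ρ) ∧
      (∀ u ∈ Z, (n u : ℤ) = MeromorphicOn.divisor f Set.univ u) ∧
      (∀ u ∈ Z, 1 ≤ n u) ∧
      AnalyticOnNhd ℂ h (ball c R₀) ∧
      (∀ z ∈ closedBall c ρ, h z ≠ 0) ∧
      (∀ z ∈ ball c R₀, f z = (∏ u ∈ Z, (z - u) ^ n u) * h z) := by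
  classical
  set U : Set ℂ := ball c R₀ with hU
  have hfU : AnalyticOnNhd ℂ f U := fun z _ => hf z
  have hmer : MeromorphicOn f U := hfU.meromorphicOn
  have hord : ∀ z, analyticOrderAt f z ≠ ⊤ := fun z h =>
    hf0 ((AnalyticOnNhd.analyticOrderAt_eq_top_iff_eq_zero z hf).1 h)
  have h₂ : ∀ u : U, meromorphicOrderAt f u ≠ ⊤ := by
    intro u
    rw [(hf u).meromorphicOrderAt_eq]
    cases h : analyticOrderAt f u with
    | top => exact absurd h (hord u)
    | coe n => simp
  have hfc : AnalyticOnNhd ℂ f (closedBall c R₀) := fun z _ => hf z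
  have h₃ : (MeromorphicOn.divisor f U).support.Finite :=
    MeromorphicOn.divisor_ball_support_finite hfc.meromorphicOn
  obtain ⟨g, hg_an, hg_ne, hfg⟩ := hmer.extract_zeros_poles h₂ h₃
  set D : ℂ → ℤ := ⇑(MeromorphicOn.divisor f U) with hD
  -- values of the divisor
  have hDval : ∀ u ∈ U, (D u : ℤ) = ((analyticOrderAt f u).map (Nat.cast : ℕ → ℤ)).untop₀ :=
    fun u hu => MeromorphicOn.AnalyticOnNhd.divisor_apply hfU hu
  have hDnat : ∀ u ∈ U, ∃ m : ℕ, analyticOrderAt f u = m ∧ D u = m := by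
    intro u hu
    cases h : analyticOrderAt f u with
    | top => exact absurd h (hord u)
    | coe m => exact ⟨m, rfl, by rw [hDval u hu, h]; simp⟩
  have hDnonneg : ∀ u, 0 ≤ D u := by
    intro u
    by_cases hu : u ∈ U
    · obtain ⟨m, _, hm⟩ := hDnat u hu; rw [hm]; positivity
    · simp [hD, hu]
  have hDsupp : ∀ u, D u ≠ 0 ↔ u ∈ U ∧ f u = 0 := by
    intro u
    by_cases hu : u ∈ U
    · obtain ⟨m, hm1, hm2⟩ := hDnat u hu
      rw [hm2]
      have h0 : m = 0 ↔ f u ≠ 0 := by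
        rw [← Nat.cast_inj (R := ℕ∞), Nat.cast_zero, ← hm1]
        exact (hf u).analyticOrderAt_eq_zero
      simp only [ne_eq, Nat.cast_eq_zero, hu, true_and]
      tauto
    · simp [hD, hu]
  -- the product as an honest function
  set S : Finset ℂ := h₃.toFinset with hS
  have hSmem : ∀ u, u ∈ S ↔ D u ≠ 0 := fun u => by simp [hS, hD]
  have hPfun : ∀ z, (∏ᶠ u, (· - u) ^ D u) z = ∏ u ∈ S, (z - u) ^ D u := by
    intro z
    rw [Function.FactorizedRational.finprod_eq_fun h₃]
    simp only
    apply finprod_eq_prod_of_mulSupport_subset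
    intro u hu
    rw [Function.mem_mulSupport] at hu
    simp only [Finset.mem_coe, hSmem]
    intro h0
    apply hu
    rw [show (MeromorphicOn.divisor f U) u = D u from rfl, h0, zpow_zero]
  -- pointwise factorization on `U`
  have hfac : ∀ z ∈ U, f z = (∏ u ∈ S, (z - u) ^ D u) * g z := by
    intro z hz
    have hcont_f : ContinuousAt f z := (hf z).continuousAt
    have hPan : AnalyticAt ℂ (fun z => ∏ u ∈ S, (z - u) ^ D u) z := by
      apply Finset.analyticAt_fun_prod
      intro u _
      rcases eq_or_ne z u with rfl | hzu
      · exact AnalyticAt.fun_zpow_nonneg (by fun_prop) (hDnonneg z)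
      · exact AnalyticAt.fun_zpow (by fun_prop) (sub_ne_zero.2 hzu)
    have hcont_r : ContinuousAt (fun z => (∏ u ∈ S, (z - u) ^ D u) * g z) z :=
      (hPan.continuousAt).mul (hg_an z hz).continuousAt
    have hev : f =ᶠ[𝓝[≠] z] fun z => (∏ u ∈ S, (z - u) ^ D u) * g z := by
      have h1 := mem_codiscreteWithin_iff_forall_mem_nhdsNE.1 hfg z hz
      have h2 : U ∈ 𝓝[≠] z := mem_nhdsWithin_of_mem_nhds (isOpen_ball.mem_nhds hz)
      filter_upwards [h1, h2] with w hw1 hw2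
      rcases hw1 with hw1 | hw1
      · rw [Set.mem_setOf_eq] at hw1
        rw [hw1, Pi.smul_apply', hPfun, smul_eq_mul]
      · exact absurd hw2 hw1
    exact ((hcont_f.eventuallyEq_nhds_iff_eventuallyEq_nhdsNE hcont_r).1 hev).eq_of_nhds
  -- split the zeros at radius `ρ`
  set Z : Finset ℂ := S.filter (fun u => u ∈ closedBall c ρ) with hZ
  set Sout : Finset ℂ := S.filter (fun u => u ∉ closedBall c ρ) with hSout
  set n : ℂ → ℕ := fun u => (D u).toNat with hn
  have hnD : ∀ u, (n u : ℤ) = D u := fun u => Int.toNat_of_nonneg (hDnonneg u)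
  have hpow : ∀ z u, (z - u) ^ D u = (z - u) ^ n u := fun z u => by
    rw [← hnD, zpow_natCast]
  set h : ℂ → ℂ := fun z => (∏ u ∈ Sout, (z - u) ^ n u) * g z with hh
  have hρU : closedBall c ρ ⊆ U := closedBall_subset_ball hρR
  refine ⟨Z, n, h, fun u => ?_, fun u hu => ?_, fun u hu => ?_, ?_, fun z hz => ?_, fun z hz => ?_⟩
  · rw [hZ, Finset.mem_filter, hSmem, hDsupp]
    constructor
    · rintro ⟨⟨_, h1⟩, h2⟩; exact ⟨h1, h2⟩
    · rintro ⟨h1, h2⟩; exact ⟨⟨hρU h2, h1⟩, h2⟩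
  · rw [hnD]
    have hu' : u ∈ U := hρU (Finset.mem_filter.1 hu).2
    rw [hD, MeromorphicOn.divisor_apply hmer hu',
      MeromorphicOn.divisor_apply (fun z _ => (hf z).meromorphicAt) (Set.mem_univ u)]
  · have h1 : D u ≠ 0 := (hSmem u).1 (Finset.mem_filter.1 hu).1
    have h2 := hDnonneg u
    have : (1 : ℤ) ≤ n u := by rw [hnD]; omega
    exact_mod_cast this
  · intro z hz
    apply AnalyticAt.mul _ (hg_an z hz)
    apply Finset.analyticAt_fun_prod
    intro u _
    fun_prop
  · simp only [hh]
    apply mul_ne_zero _ (hg_ne ⟨z, hρU hz⟩)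
    rw [Finset.prod_ne_zero_iff]
    intro u hu
    apply pow_ne_zero
    rw [sub_ne_zero]
    rintro rfl
    exact (Finset.mem_filter.1 hu).2 hz
  · rw [hfac z hz, hh, ← mul_assoc]
    congr 1
    rw [← Finset.prod_filter_mul_prod_filter_not S (fun u => u ∈ closedBall c ρ)]
    simp only [hpow]
    rfl

/-- Enumerate a finite set of points with multiplicities as an indexed family. [folklore] -/
theorem zeros_enum (Z : Finset ℂ) (n : ℂ → ℕ) :
    ∃ (N : ℕ) (w : Fin N → ℂ), N = ∑ u ∈ Z, n u ∧ (∀ i, w i ∈ Z) ∧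
      ∀ z : ℂ, ∏ u ∈ Z, (z - u) ^ n u = ∏ i, (z - w i) := by
  classical
  set P : Finset (Σ _ : ℂ, ℕ) := Z.sigma fun u => Finset.range (n u) with hP
  set e := P.equivFin
  refine ⟨P.card, fun i => (e.symm i).1.1, ?_, fun i => ?_, fun z => ?_⟩
  · rw [hP, Finset.card_sigma]; simp
  · have h1 : (↑(e.symm i) : Σ _ : ℂ, ℕ) ∈ Z.sigma fun u => Finset.range (n u) := (e.symm i).2
    exact (Finset.mem_sigma.1 h1).1
  · have h1 : ∏ u ∈ Z, (z - u) ^ n u = ∏ p ∈ P, (z - p.1) := by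
      rw [hP, Finset.prod_sigma]
      refine Finset.prod_congr rfl fun u _ => ?_
      simp
    rw [h1, ← Finset.prod_coe_sort P, ← Equiv.prod_comp e.symm]

/-- Jensen's inequality bounds the total multiplicity of extracted zeros. [folklore] -/
theorem count_le_jensen {f : ℂ → ℂ} (hf : ∀ z, AnalyticAt ℂ f z) {c' : ℂ} {r R M : ℝ}
    (Z : Finset ℂ) (n : ℂ → ℕ) (hZ : ∀ u ∈ Z, u ∈ closedBall c' r)
    (hn : ∀ u ∈ Z, (n u : ℤ) = MeromorphicOn.divisor f Set.univ u) (hr : 0 < r) (hrR : r < R)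
    (hM : 1 ≤ M) (hfc : f c' ≠ 0) (hbound : ∀ z ∈ sphere c' R, ‖f z‖ ≤ M) :
    ((∑ u ∈ Z, n u : ℕ) : ℝ) ≤ Real.log (M / ‖f c'‖) / Real.log (R / r) := by
  classical
  have hR : 0 < R := hr.trans hrR
  have hfa : AnalyticOnNhd ℂ f (closedBall c' |R|) := fun z _ => hf z
  have J := hfa.sum_divisor_le (r := r) (by rwa [abs_of_pos hr]) (by rwa [abs_of_pos hr, abs_of_pos hR])
    hM hfc (by rwa [abs_of_pos hR])
  rw [abs_of_pos hr] at J
  refine le_trans ?_ J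
  set D : ℂ → ℤ := ⇑(MeromorphicOn.divisor f (closedBall c' r)) with hD
  have hfr : AnalyticOnNhd ℂ f (closedBall c' r) := fun z _ => hf z
  have hDnonneg : ∀ u, 0 ≤ D u := by
    intro u
    by_cases hu : u ∈ closedBall c' r
    · rw [hD, MeromorphicOn.AnalyticOnNhd.divisor_apply hfr hu]
      cases analyticOrderAt f u with
      | top => simp
      | coe m => simp
    · simp [hD, hu]
  have hDZ : ∀ u ∈ Z, D u = n u := by
    intro u hu
    rw [hn u hu, hD, MeromorphicOn.divisor_apply hfr.meromorphicOn (hZ u hu),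
      MeromorphicOn.divisor_apply (fun z _ => (hf z).meromorphicAt) (Set.mem_univ u)]
  have hfin : (Function.support D).Finite :=
    (MeromorphicOn.divisor f (closedBall c' r)).finiteSupport (isCompact_closedBall c' r)
  have hfs : ∑ᶠ u, D u = ∑ u ∈ hfin.toFinset, D u :=
    finsum_eq_sum_of_support_subset D (by simp)
  have hle : (∑ u ∈ Z, (n u : ℤ)) ≤ ∑ u ∈ hfin.toFinset, D u := by
    calc (∑ u ∈ Z, (n u : ℤ)) = ∑ u ∈ Z, D u := Finset.sum_congr rfl fun u hu => (hDZ u hu).symm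
      _ ≤ ∑ u ∈ Z ∪ hfin.toFinset, D u :=
          Finset.sum_le_sum_of_subset_of_nonneg Finset.subset_union_left fun u _ _ => hDnonneg u
      _ = ∑ u ∈ hfin.toFinset, D u := by
          symm
          apply Finset.sum_subset Finset.subset_union_right
          intro u _ hu
          simpa using hu
  have : ((∑ u ∈ Z, n u : ℕ) : ℝ) = ((∑ u ∈ Z, (n u : ℤ) : ℤ) : ℝ) := by push_cast; rfl
  rw [this, show (∑ᶠ u, (MeromorphicOn.divisor f (closedBall c' r)) u) = ∑ᶠ u, D u from rfl, hfs]
  exact_mod_cast hle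

/-- Selecting `k` nearest indices: a subset `T` of size `k` whose keys are not larger than the keys
outside. [folklore] -/
theorem exists_nearest {ι : Type*} [DecidableEq ι] (s : Finset ι) (δ : ι → ℝ) (k : ℕ)
    (hk : k ≤ s.card) :
    ∃ T : Finset ι, T ⊆ s ∧ T.card = k ∧ ∀ i ∈ T, ∀ j ∈ s, j ∉ T → δ i ≤ δ j := by
  induction k with
  | zero => exact ⟨∅, Finset.empty_subset _, rfl, by simp⟩
  | succ k ih =>
    obtain ⟨T, hTs, hTc, hT⟩ := ih (by omega)
    have hne : (s \ T).Nonempty := by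
      rw [← Finset.card_pos, Finset.card_sdiff_of_subset hTs]; omega
    obtain ⟨j₀, hj₀, hmin⟩ := Finset.exists_min_image (s \ T) δ hne
    rw [Finset.mem_sdiff] at hj₀
    refine ⟨insert j₀ T, Finset.insert_subset hj₀.1 hTs, by rw [Finset.card_insert_of_notMem hj₀.2, hTc], ?_⟩
    intro i hi j hj hjT
    rw [Finset.mem_insert] at hi
    have hjT' : j ∉ T := fun h => hjT (Finset.mem_insert_of_mem h)
    rcases hi with rfl | hi
    · exact hmin j (Finset.mem_sdiff.2 ⟨hj, hjT'⟩)
    · exact hT i hi j hj hjT'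


/-- **Effective zero product** (Friedland 2026, Prop 2.1, in the all-scales disk-growth setting and
with plain polynomial division in place of Blaschke products).  Let `f` be entire, not the zero
function, with `‖f x₀‖ ≥ 1` at some `x₀ ∈ I₀ = [-1/2, 1/2]`, and assume the disk-growth bound
`sup_{D̄(z₀,R)} |f| ≤ e^{aR+b} (R/r)^d sup_{D̄(z₀,r)} |f|` for all centres and radii `0 < r ≤ R`
(`a, b ≥ 0`, `d ≥ 1`).  Then the zeros `w_1,…,w_N` of `f` in `D̄(0,2)` (with multiplicity) number
`N ≤ 35(a+b+d)`, and for every `x ∈ I₀` there are at most `d` of them, `T ⊆ {1,…,N}`, with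
`‖f x‖ ≥ e^{-2000(a+b+d)} ∏_{i∈T} min(1, |x - Re w_i|)`.
[cite: Friedland2026DiskGrowthRemez, Prop 2.1] -/
theorem effective_zero_product {f : ℂ → ℂ} (hf : ∀ z, AnalyticAt ℂ f z) (hf0 : f ≠ 0)
    {a b : ℝ} {d : ℕ} (ha : 0 ≤ a) (hb : 0 ≤ b) (hd : 1 ≤ d)
    (hDG : ∀ (z₀ : ℂ) (r R S : ℝ), 0 < r → r ≤ R →
      (∀ ζ ∈ closedBall z₀ r, ‖f ζ‖ ≤ S) → ∀ z ∈ closedBall z₀ R,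
        ‖f z‖ ≤ Real.exp (a * R + b) * (R / r) ^ d * S)
    (hone : ∃ x₀ : ℝ, x₀ ∈ Icc (-1/2 : ℝ) (1/2) ∧ 1 ≤ ‖f x₀‖) :
    ∃ (N : ℕ) (w : Fin N → ℂ), (N : ℝ) ≤ 35 * (a + b + d) ∧
      ∀ x : ℝ, x ∈ Icc (-1/2 : ℝ) (1/2) → ∃ T : Finset (Fin N), T.card ≤ d ∧
        Real.exp (-(2000 * (a + b + d))) * ∏ i ∈ T, min 1 |x - (w i).re| ≤ ‖f x‖ := by
  classical
  have hd0 : (1 : ℝ) ≤ d := by exact_mod_cast hd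
  -- (1) zeros in `D̄(0,2)` and the factorization on `D(0,5)`
  obtain ⟨Z, n, h, hZ, hndiv, hn1, hh_an, hh_ne, hfac⟩ :=
    extract_zeros hf hf0 0 (ρ := 2) (R₀ := 5) (by norm_num)
  obtain ⟨N, w, hN, hwZ, hprod⟩ := zeros_enum Z n
  have hw2 : ∀ i, ‖w i‖ ≤ 2 := fun i => by
    have := ((hZ (w i)).1 (hwZ i)).2
    rwa [mem_closedBall, dist_zero_right] at this
  have hfac' : ∀ z ∈ ball (0 : ℂ) 5, f z = (∏ i, (z - w i)) * h z := fun z hz => by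
    rw [hfac z hz, hprod]
  -- (2) the maximum `M₁` of `|f|` on `D̄(0,1)`
  obtain ⟨x₀, hx₀, hfx₀⟩ := hone
  have hcont : Continuous fun z => ‖f z‖ :=
    continuous_norm.comp (continuous_iff_continuousAt.2 fun z => (hf z).continuousAt)
  obtain ⟨w₁, hw₁, hw₁max⟩ := (isCompact_closedBall (0 : ℂ) 1).exists_isMaxOn
    ⟨0, mem_closedBall_self zero_le_one⟩ hcont.continuousOn
  set M₁ : ℝ := ‖f w₁‖ with hM₁
  have hw₁max' : ∀ z ∈ closedBall (0 : ℂ) 1, ‖f z‖ ≤ M₁ := fun z hz => hw₁max hz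
  have hw₁n : ‖w₁‖ ≤ 1 := by simpa using hw₁
  have hx₀b : (x₀ : ℂ) ∈ closedBall (0 : ℂ) 1 := by
    rw [mem_closedBall, dist_zero_right, Complex.norm_real, Real.norm_eq_abs, abs_le]
    constructor <;> linarith [hx₀.1, hx₀.2]
  have hM₁1 : 1 ≤ M₁ := hfx₀.trans (hw₁max' _ hx₀b)
  have hM₁0 : 0 < M₁ := by linarith
  have hfw₁ : f w₁ ≠ 0 := by
    intro h0; rw [hM₁, h0, norm_zero] at hM₁1; linarith
  -- (3) disk growth from `D̄(0,1)` to `D̄(0,4)` and `D̄(0,5)`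
  set M₄ : ℝ := Real.exp (a * 4 + b) * (4 / 1) ^ d * M₁ with hM₄
  set M₅ : ℝ := Real.exp (a * 5 + b) * (5 / 1) ^ d * M₁ with hM₅
  have hM₄b : ∀ z ∈ closedBall (0 : ℂ) 4, ‖f z‖ ≤ M₄ :=
    hDG 0 1 4 M₁ one_pos (by norm_num) hw₁max'
  have hM₅b : ∀ z ∈ closedBall (0 : ℂ) 5, ‖f z‖ ≤ M₅ :=
    hDG 0 1 5 M₁ one_pos (by norm_num) hw₁max'
  have hM₁M₄ : M₁ ≤ M₄ := hM₄b w₁ (closedBall_subset_closedBall (by norm_num) hw₁)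
  have hM₄1 : 1 ≤ M₄ := hM₁1.trans hM₁M₄
  have hM₄0 : 0 < M₄ := by linarith
  have hM₁M₅ : M₁ ≤ M₅ := hM₅b w₁ (closedBall_subset_closedBall (by norm_num) hw₁)
  -- (4) zero count
  have hNle : (N : ℝ) ≤ 35 * (a + b + d) := by
    have hZ' : ∀ u ∈ Z, u ∈ closedBall w₁ 3 := by
      intro u hu
      have hu2 : ‖u‖ ≤ 2 := by simpa using ((hZ u).1 hu).2
      rw [mem_closedBall, dist_eq_norm]
      calc ‖u - w₁‖ ≤ ‖u‖ + ‖w₁‖ := norm_sub_le _ _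
        _ ≤ 3 := by linarith
    have hsph : ∀ z ∈ sphere w₁ (7 / 2), ‖f z‖ ≤ M₅ := by
      intro z hz
      apply hM₅b
      rw [mem_sphere, dist_eq_norm] at hz
      rw [mem_closedBall, dist_zero_right]
      calc ‖z‖ = ‖(z - w₁) + w₁‖ := by rw [sub_add_cancel]
        _ ≤ ‖z - w₁‖ + ‖w₁‖ := norm_add_le _ _
        _ ≤ 5 := by linarith
    have J := count_le_jensen hf Z n hZ' hndiv (by norm_num) (by norm_num : (3 : ℝ) < 7 / 2)
      (hM₁1.trans hM₁M₅) hfw₁ hsph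
    rw [← hN] at J
    have hlog1 : Real.log (M₅ / ‖f w₁‖) ≤ 5 * a + b + 4 * d := by
      have : M₅ / ‖f w₁‖ = Real.exp (a * 5 + b) * 5 ^ d := by
        rw [← hM₁, hM₅]; field_simp
      rw [this, Real.log_mul (Real.exp_pos _).ne' (by positivity), Real.log_exp, Real.log_pow]
      have : Real.log 5 ≤ 4 := by have := Real.log_le_sub_one_of_pos (by norm_num : (0:ℝ) < 5); linarith
      nlinarith
    have hlog2 : 1 / 7 ≤ Real.log (7 / 2 / 3) := by
      have := Real.one_sub_inv_le_log_of_pos (by norm_num : (0:ℝ) < 7 / 2 / 3)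
      norm_num at this ⊢
      linarith
    have hlog2' : 0 < Real.log (7 / 2 / 3) := by linarith
    rw [le_div_iff₀ hlog2'] at J
    nlinarith
  -- (5) bounds for the zero-free factor `h`
  have hP4 : ∀ z ∈ sphere (0 : ℂ) 4, 1 ≤ ‖∏ i, (z - w i)‖ := by
    intro z hz
    rw [mem_sphere, dist_zero_right] at hz
    rw [norm_prod]
    calc (1 : ℝ) = ∏ _i : Fin N, (1 : ℝ) := by simp
      _ ≤ ∏ i, ‖z - w i‖ := by
          apply Finset.prod_le_prod (fun _ _ => zero_le_one) fun i _ => ?_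
          have := norm_sub_norm_le z (w i)
          linarith [hw2 i]
  have hh4 : ∀ z ∈ closedBall (0 : ℂ) 4, ‖h z‖ ≤ M₄ := by
    have hdc : DiffContOnCl ℂ h (ball (0 : ℂ) 4) := by
      apply DifferentiableOn.diffContOnCl
      rw [closure_ball 0 (by norm_num)]
      exact (hh_an.mono (closedBall_subset_ball (by norm_num))).differentiableOn
    intro z hz
    apply Complex.norm_le_of_forall_mem_frontier_norm_le isBounded_ball hdc _
      (by rw [closure_ball 0 (by norm_num)]; exact hz)
    intro v hv
    rw [frontier_ball 0 (by norm_num)] at hv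
    have hv5 : v ∈ ball (0 : ℂ) 5 := by
      rw [mem_sphere, dist_zero_right] at hv; rw [mem_ball, dist_zero_right]; linarith
    have h1 := hM₄b v (sphere_subset_closedBall hv)
    rw [hfac' v hv5, norm_mul] at h1
    have h2 := hP4 v hv
    calc ‖h v‖ = 1 * ‖h v‖ := (one_mul _).symm
      _ ≤ ‖∏ i, (v - w i)‖ * ‖h v‖ := by gcongr
      _ ≤ M₄ := h1
  have hPw₁ : ‖∏ i, (w₁ - w i)‖ ≤ 3 ^ N := by
    rw [norm_prod]
    calc ∏ i, ‖w₁ - w i‖ ≤ ∏ _i : Fin N, (3 : ℝ) := by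
          apply Finset.prod_le_prod (fun i _ => norm_nonneg _) fun i _ => ?_
          calc ‖w₁ - w i‖ ≤ ‖w₁‖ + ‖w i‖ := norm_sub_le _ _
            _ ≤ 3 := by linarith [hw2 i]
      _ = 3 ^ N := by simp
  have hw₁5 : w₁ ∈ ball (0 : ℂ) 5 := by rw [mem_ball, dist_zero_right]; linarith
  have hhw₁ : M₁ ≤ 3 ^ N * ‖h w₁‖ := by
    have h1 : M₁ = ‖∏ i, (w₁ - w i)‖ * ‖h w₁‖ := by rw [hM₁, hfac' w₁ hw₁5, norm_mul]
    rw [h1]; gcongr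
  have hhw₁0 : 0 < ‖h w₁‖ := by
    have : (0 : ℝ) < 3 ^ N := by positivity
    nlinarith
  set K₁ : ℝ := 21 * (4 * a + b + 3 * d + 2 * N) with hK₁
  have hhlow : ∀ v ∈ closedBall (0 : ℂ) (3 / 2), Real.exp (-K₁) ≤ ‖h v‖ := by
    intro v hv
    have key := zero_free_lower (hh_an.mono (closedBall_subset_ball (by norm_num)))
      hh_ne (fun z hz => hh4 z (closedBall_subset_closedBall (by norm_num) hz)) hw₁ hv
      (M := M₄)
    have hv0 : h v ≠ 0 := hh_ne v (closedBall_subset_closedBall (by norm_num) hv)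
    have hlogM₄ : Real.log M₄ - Real.log M₁ ≤ 4 * a + b + 3 * d := by
      rw [← Real.log_div hM₄0.ne' hM₁0.ne']
      have : M₄ / M₁ = Real.exp (a * 4 + b) * 4 ^ d := by rw [hM₄]; field_simp
      rw [this, Real.log_mul (Real.exp_pos _).ne' (by positivity), Real.log_exp, Real.log_pow]
      have : Real.log 4 ≤ 3 := by have := Real.log_le_sub_one_of_pos (by norm_num : (0:ℝ) < 4); linarith
      nlinarith
    have hloghw₁ : Real.log M₁ - N * 2 ≤ Real.log ‖h w₁‖ := by
      have h1 := Real.log_le_log hM₁0 hhw₁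
      rw [Real.log_mul (by positivity) hhw₁0.ne', Real.log_pow] at h1
      have : Real.log 3 ≤ 2 := by have := Real.log_le_sub_one_of_pos (by norm_num : (0:ℝ) < 3); linarith
      nlinarith [Nat.cast_nonneg (α := ℝ) N]
    have hlogM₄0 : 0 ≤ Real.log M₄ := Real.log_nonneg hM₄1
    rw [← Real.log_le_log_iff (Real.exp_pos _) (norm_pos_iff.2 hv0), Real.log_exp]
    nlinarith [Nat.cast_nonneg (α := ℝ) N]
  -- (6) numerical bookkeeping for the final constant
  have hN0 : (0 : ℝ) ≤ N := Nat.cast_nonneg N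
  have hexpK : Real.exp (-(2000 * (a + b + d))) ≤
      Real.exp (-K₁) * Real.exp (-(9 * a + 2 * b + 17 * d + 3 * N)) := by
    rw [← Real.exp_add]
    apply Real.exp_le_exp.2
    rw [hK₁]
    linarith only [hNle, ha, hb, hd0, hN0]
  have h4exp : ∀ m : ℕ, (4 : ℝ) ^ m ≤ Real.exp (3 * m) := fun m => by
    rw [mul_comm, Real.exp_nat_mul]
    exact pow_le_pow_left₀ (by norm_num) (by linarith [Real.add_one_le_exp (3 : ℝ)]) m
  have h92exp : ((9 : ℝ) / 2) ^ d ≤ Real.exp (7 / 2 * d) := by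
    rw [mul_comm, Real.exp_nat_mul]
    exact pow_le_pow_left₀ (by norm_num) (by linarith [Real.add_one_le_exp (7 / 2 : ℝ)]) d
  -- (7) the claim at a point `x ∈ I₀`
  refine ⟨N, w, hNle, fun x hx => ?_⟩
  set δ : Fin N → ℝ := fun i => ‖(x : ℂ) - w i‖ with hδ
  have hxn : ‖(x : ℂ)‖ ≤ 1 / 2 := by
    rw [Complex.norm_real, Real.norm_eq_abs, abs_le]; constructor <;> linarith only [hx.1, hx.2]
  have hx5 : (x : ℂ) ∈ ball (0 : ℂ) 5 := by rw [mem_ball, dist_zero_right]; linarith only [hxn]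
  have hx32 : (x : ℂ) ∈ closedBall (0 : ℂ) (3 / 2) := by
    rw [mem_closedBall, dist_zero_right]; linarith only [hxn]
  have hfx : ‖f x‖ = (∏ i, δ i) * ‖h x‖ := by rw [hfac' x hx5, norm_mul, norm_prod]
  have hmin_le : ∀ i, min 1 |x - (w i).re| ≤ δ i := fun i => (min_le_right _ _).trans (by
    have := Complex.abs_re_le_norm ((x : ℂ) - w i)
    simpa using this)
  have hmin_nn : ∀ i, 0 ≤ min 1 |x - (w i).re| := fun i => le_min zero_le_one (abs_nonneg _)
  have hδnn : ∀ i, 0 ≤ δ i := fun i => norm_nonneg _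
  set I_loc : Finset (Fin N) := Finset.univ.filter (fun i => δ i ≤ 1) with hIloc
  set Far : Finset (Fin N) := Finset.univ.filter (fun i => ¬ δ i ≤ 1) with hFar
  have hFar1 : 1 ≤ ∏ i ∈ Far, δ i := by
    calc (1 : ℝ) = ∏ _i ∈ Far, (1 : ℝ) := by simp
      _ ≤ ∏ i ∈ Far, δ i := Finset.prod_le_prod (fun _ _ => zero_le_one) fun i hi =>
          le_of_lt (not_le.1 (Finset.mem_filter.1 hi).2)
  have hsplit0 : ∀ g : Fin N → ℝ, ∏ i, g i = (∏ i ∈ I_loc, g i) * ∏ i ∈ Far, g i := fun g =>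
    (Finset.prod_filter_mul_prod_filter_not _ _ _).symm
  have hhx : Real.exp (-K₁) ≤ ‖h x‖ := hhlow _ hx32
  by_cases hcard : I_loc.card ≤ d
  · -- Case A: at most `d` zeros within distance `1`
    refine ⟨I_loc, hcard, ?_⟩
    have h3 : ∏ i ∈ I_loc, min 1 |x - (w i).re| ≤ ∏ i ∈ I_loc, δ i :=
      Finset.prod_le_prod (fun i _ => hmin_nn i) fun i _ => hmin_le i
    have hK₂0 : Real.exp (-(9 * a + 2 * b + 17 * d + 3 * N)) ≤ 1 := by
      rw [Real.exp_le_one_iff]; linarith only [ha, hb, hd0, hN0]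
    calc Real.exp (-(2000 * (a + b + d))) * ∏ i ∈ I_loc, min 1 |x - (w i).re|
        ≤ (Real.exp (-K₁) * Real.exp (-(9 * a + 2 * b + 17 * d + 3 * N))) * ∏ i ∈ I_loc, δ i :=
          mul_le_mul hexpK h3 (Finset.prod_nonneg fun i _ => hmin_nn i) (by positivity)
      _ ≤ (‖h x‖ * 1) * ((∏ i ∈ I_loc, δ i) * ∏ i ∈ Far, δ i) := by
          have hL : Real.exp (-K₁) * Real.exp (-(9 * a + 2 * b + 17 * d + 3 * N)) ≤ ‖h x‖ * 1 :=
            mul_le_mul hhx hK₂0 (Real.exp_pos _).le (norm_nonneg _)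
          have hR : ∏ i ∈ I_loc, δ i ≤ (∏ i ∈ I_loc, δ i) * ∏ i ∈ Far, δ i :=
            le_mul_of_one_le_right (Finset.prod_nonneg fun i _ => hδnn i) hFar1
          exact mul_le_mul hL hR (Finset.prod_nonneg fun i _ => hδnn i)
            (mul_nonneg (norm_nonneg _) zero_le_one)
      _ = ‖f x‖ := by rw [hfx, hsplit0 δ]; ring
  · -- Case B: keep the `d` nearest zeros, the others form the tail
    push Not at hcard
    obtain ⟨T, hTsub, hTcard, hTnear⟩ := exists_nearest I_loc δ d hcard.le
    refine ⟨T, hTcard.le, ?_⟩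
    set J : Finset (Fin N) := I_loc \ T with hJ
    have hJne : J.Nonempty := by
      rw [← Finset.card_pos, hJ, Finset.card_sdiff_of_subset hTsub]; omega
    obtain ⟨j₀, hj₀, hj₀min⟩ := Finset.exists_min_image J δ hJne
    set ρ : ℝ := δ j₀ with hρ
    have hj₀' := Finset.mem_sdiff.1 hj₀
    have hρT : ∀ i ∈ T, δ i ≤ ρ := fun i hi => hTnear i hi j₀ hj₀'.1 hj₀'.2
    have hρJ : ∀ j ∈ J, ρ ≤ δ j := hj₀min
    have hρ1 : ρ ≤ 1 := (Finset.mem_filter.1 hj₀'.1).2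
    have hρ0 : 0 ≤ ρ := norm_nonneg _
    rcases hρ0.eq_or_lt with hρz | hρpos
    · -- `ρ = 0`: the product over `T` vanishes
      have hTne : T.Nonempty := by rw [← Finset.card_pos, hTcard]; omega
      obtain ⟨i₀, hi₀⟩ := hTne
      have h0 : min 1 |x - (w i₀).re| = 0 :=
        le_antisymm ((hmin_le i₀).trans ((hρT i₀ hi₀).trans_eq hρz.symm)) (hmin_nn i₀)
      rw [Finset.prod_eq_zero hi₀ h0, mul_zero]
      exact norm_nonneg _
    -- `ρ > 0`
    set Ptail : ℝ := ∏ j ∈ J, δ j with hPtail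
    have hPtail0 : 0 ≤ Ptail := Finset.prod_nonneg fun _ _ => norm_nonneg _
    have hsplit : ∀ g : Fin N → ℝ, ∏ i, g i = (∏ i ∈ T, g i) * (∏ i ∈ J, g i) * ∏ i ∈ Far, g i := by
      intro g
      rw [hsplit0 g, hJ, ← Finset.prod_sdiff hTsub]
      ring
    have hnotloc : ∀ i ∈ Far, i ∉ T ∧ i ∉ J := by
      intro i hi
      have hi' : i ∉ I_loc := by
        intro h'; exact (Finset.mem_filter.1 hi).2 (Finset.mem_filter.1 h').2
      exact ⟨fun h' => hi' (hTsub h'), fun h' => hi' (Finset.mem_sdiff.1 h').1⟩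
    -- (i) `|f| ≤ 4^N ρ^d Ptail M₄` on `D̄(x, ρ)`
    have hSx : ∀ z ∈ closedBall (x : ℂ) ρ, ‖f z‖ ≤ (4 : ℝ) ^ N * ρ ^ d * Ptail * M₄ := by
      intro z hz
      rw [mem_closedBall, dist_eq_norm] at hz
      have hzn : ‖z‖ ≤ 3 / 2 := by
        calc ‖z‖ = ‖(z - x) + x‖ := by rw [sub_add_cancel]
          _ ≤ ‖z - (x : ℂ)‖ + ‖(x : ℂ)‖ := norm_add_le _ _
          _ ≤ 3 / 2 := by linarith only [hz, hxn, hρ1]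
      have hz5 : z ∈ ball (0 : ℂ) 5 := by rw [mem_ball, dist_zero_right]; linarith only [hzn]
      have hz4 : z ∈ closedBall (0 : ℂ) 4 := by rw [mem_closedBall, dist_zero_right]; linarith only [hzn]
      set g : Fin N → ℝ := fun i => if i ∈ T then ρ else if i ∈ J then δ i else 1 with hg
      have hfac_le : ∀ i, ‖z - w i‖ ≤ 4 * g i := by
        intro i
        have htri : ‖z - w i‖ ≤ ‖z - (x : ℂ)‖ + δ i := by
          calc ‖z - w i‖ = ‖(z - x) + ((x : ℂ) - w i)‖ := by rw [sub_add_sub_cancel]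
            _ ≤ ‖z - (x : ℂ)‖ + δ i := norm_add_le _ _
        by_cases hiT : i ∈ T
        · have hgi : g i = ρ := if_pos hiT
          rw [hgi]; linarith only [hρT i hiT, htri, hz, hρ0]
        · by_cases hiJ : i ∈ J
          · have hgi : g i = δ i := by
              show (if i ∈ T then ρ else if i ∈ J then δ i else 1) = δ i
              rw [if_neg hiT, if_pos hiJ]
            rw [hgi]; linarith only [hρJ i hiJ, htri, hz, hρ0]
          · have hgi : g i = 1 := by
              show (if i ∈ T then ρ else if i ∈ J then δ i else 1) = 1
              rw [if_neg hiT, if_neg hiJ]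
            rw [hgi]
            calc ‖z - w i‖ ≤ ‖z‖ + ‖w i‖ := norm_sub_le _ _
              _ ≤ 4 * 1 := by linarith only [hw2 i, hzn]
      have hprodg : ∏ i, g i = ρ ^ d * Ptail := by
        rw [hsplit g]
        have h1 : ∏ i ∈ T, g i = ρ ^ d := by
          rw [Finset.prod_congr rfl (fun i hi => (if_pos hi : g i = ρ)), Finset.prod_const, hTcard]
        have h2 : ∏ i ∈ J, g i = Ptail := Finset.prod_congr rfl fun i hi => by
          have : i ∉ T := (Finset.mem_sdiff.1 hi).2
          show (if i ∈ T then ρ else if i ∈ J then δ i else 1) = δ i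
          rw [if_neg this, if_pos hi]
        have h3 : ∏ i ∈ Far, g i = 1 := Finset.prod_eq_one fun i hi => by
          show (if i ∈ T then ρ else if i ∈ J then δ i else 1) = 1
          rw [if_neg (hnotloc i hi).1, if_neg (hnotloc i hi).2]
        rw [h1, h2, h3, mul_one]
      rw [hfac' z hz5, norm_mul, norm_prod]
      calc (∏ i, ‖z - w i‖) * ‖h z‖ ≤ (∏ i, 4 * g i) * M₄ :=
            mul_le_mul (Finset.prod_le_prod (fun i _ => norm_nonneg _) fun i _ => hfac_le i)
              (hh4 z hz4) (norm_nonneg _)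
              (Finset.prod_nonneg fun i _ => by linarith only [norm_nonneg (z - w i), hfac_le i])
        _ = 4 ^ N * ρ ^ d * Ptail * M₄ := by
            rw [Finset.prod_mul_distrib, Finset.prod_const, Finset.card_univ, Fintype.card_fin, hprodg]
            ring
    -- (ii) disk growth from `D̄(x,ρ)` to `D̄(x, 9/2) ∋ w₁`
    have hw₁x : w₁ ∈ closedBall (x : ℂ) (9 / 2) := by
      rw [mem_closedBall, dist_eq_norm]
      calc ‖w₁ - x‖ ≤ ‖w₁‖ + ‖(x : ℂ)‖ := norm_sub_le _ _
        _ ≤ 9 / 2 := by linarith only [hw₁n, hxn]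
    have key := hDG x ρ (9 / 2) _ hρpos (by linarith only [hρ1]) hSx w₁ hw₁x
    set A : ℝ := Real.exp (a * (9 / 2) + b) * (9 / 2) ^ d * 4 ^ N * (Real.exp (a * 4 + b) * 4 ^ d)
      with hA
    have hA0 : 0 < A := by positivity
    have key2 : 1 ≤ A * Ptail := by
      have h1 : (9 / 2 / ρ) ^ d * ρ ^ d = (9 / 2) ^ d := by
        rw [div_pow, div_mul_cancel₀ _ (pow_ne_zero d hρpos.ne')]
      have h2 : M₁ ≤ (A * Ptail) * M₁ := by
        calc M₁ = ‖f w₁‖ := rfl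
          _ ≤ Real.exp (a * (9 / 2) + b) * (9 / 2 / ρ) ^ d * (4 ^ N * ρ ^ d * Ptail * M₄) := key
          _ = (A * Ptail) * M₁ := by
              rw [hA, hM₄]
              calc Real.exp (a * (9 / 2) + b) * (9 / 2 / ρ) ^ d *
                    (4 ^ N * ρ ^ d * Ptail * (Real.exp (a * 4 + b) * (4 / 1) ^ d * M₁))
                  = Real.exp (a * (9 / 2) + b) * ((9 / 2 / ρ) ^ d * ρ ^ d) * 4 ^ N * Ptail *
                      (Real.exp (a * 4 + b) * 4 ^ d) * M₁ := by ring
                _ = _ := by rw [h1]; ring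
      exact (le_mul_iff_one_le_left hM₁0).1 h2
    -- (iii) the tail product is not small
    have hAexp : A ≤ Real.exp (9 * a + 2 * b + 17 * d + 3 * N) := by
      have h4N := h4exp N
      have h4d := h4exp d
      calc A ≤ Real.exp (a * (9 / 2) + b) * Real.exp (7 / 2 * d) * Real.exp (3 * N) *
            (Real.exp (a * 4 + b) * Real.exp (3 * d)) := by
            rw [hA]; gcongr
        _ ≤ Real.exp (9 * a + 2 * b + 17 * d + 3 * N) := by
            simp only [← Real.exp_add]
            exact Real.exp_le_exp.2 (by linarith only [ha, hb, hd0, hN0])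
    have hPtail : Real.exp (-(9 * a + 2 * b + 17 * d + 3 * N)) ≤ Ptail := by
      rw [Real.exp_neg, inv_le_iff_one_le_mul₀ (Real.exp_pos _)]
      calc 1 ≤ A * Ptail := key2
        _ ≤ Real.exp (9 * a + 2 * b + 17 * d + 3 * N) * Ptail := by gcongr
        _ = Ptail * Real.exp (9 * a + 2 * b + 17 * d + 3 * N) := mul_comm _ _
    -- (iv) conclusion
    have h3 : ∏ i ∈ T, min 1 |x - (w i).re| ≤ ∏ i ∈ T, δ i :=
      Finset.prod_le_prod (fun i _ => hmin_nn i) fun i _ => hmin_le i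
    calc Real.exp (-(2000 * (a + b + d))) * ∏ i ∈ T, min 1 |x - (w i).re|
        ≤ (Real.exp (-K₁) * Real.exp (-(9 * a + 2 * b + 17 * d + 3 * N))) * ∏ i ∈ T, δ i :=
          mul_le_mul hexpK h3 (Finset.prod_nonneg fun i _ => hmin_nn i) (by positivity)
      _ ≤ (‖h x‖ * Ptail) * ((∏ i ∈ T, δ i) * ∏ i ∈ Far, δ i) := by
          have hL : Real.exp (-K₁) * Real.exp (-(9 * a + 2 * b + 17 * d + 3 * N)) ≤ ‖h x‖ * Ptail :=
            mul_le_mul hhx hPtail (Real.exp_pos _).le (norm_nonneg _)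
          have hR : ∏ i ∈ T, δ i ≤ (∏ i ∈ T, δ i) * ∏ i ∈ Far, δ i :=
            le_mul_of_one_le_right (Finset.prod_nonneg fun i _ => hδnn i) hFar1
          exact mul_le_mul hL hR (Finset.prod_nonneg fun i _ => hδnn i)
            (mul_nonneg (norm_nonneg _) hPtail0)
      _ = ‖f x‖ := by rw [hfx, hsplit δ]; ring


end TuranNazarov

end Literature.Analysis.Approximation
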